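import Summits.CriticalPhenomena.PercolationContinuityZ3.Theorems.PercNearOneGluingNoHeavyLowerTailCILReduction
import HarnessLib

/-!
# `NoHeavyLowerTail` (stmt-CriticalPhenomena-4575) — the crux follows from ONE exchange inequality: the ANCHORED UNION
# TRANSFER (AUT) at the lightest relay

Typed reduction, prover `prim-gen-induct` (gen 10), `--supports stmt-CriticalPhenomena-4575`.  No definitions, no named
facts, no sorries; standard axioms.

Setting: bond percolation `μ = prodBernoulli w` on `Fin n`, a relay set `A`, an observer `o ∉ A`; for a vertex `v` write
`light(v)` for the event `2·#{x ∈ A : v ↔ x} ≤ |A|` ("the open cluster of `v` carries at most half of the relays") and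
`N = #{x ∈ A : o ↔ x}`.  The tree reduces the crux to the CUMULATIVE ISOLATION LEMMA at level `⌊|A|/2⌋`
(`noHeavyLowerTail_of_cumulativeIsolation`: `∃ a ∈ A, μ{1 ≤ N ∧ 2N ≤ |A|} ≤ μ(light a)`, constant 2, `|A|`-uniform).
Splitting `{1 ≤ N, light o}` along `{o ↔ a}` for the LIGHTEST relay `a` (the one maximising `μ(light a)`): on `{o ↔ a}`
the clusters of `o` and `a` coincide, so that part is `≤ μ(light a, o ↔ a)` for free; off it, `1 ≤ N` says that `o` is
joined to `W = A ∖ {a}`.  Hence the crux follows from the single exchange inequality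

  (AUT)  `μ(light g) ≤ μ(light a) ∀ g ∈ A  ⟹  μ(o ↮ a, o ↔ W, light o) ≤ μ(o ↮ a, o ↔ W, light a)`,   `W = A ∖ {a}`,

the ANCHORED UNION TRANSFER of the prover's line (BLOBQUOTIENT.md §25 (vii): 0 violations in 36 179 exact instances +
kit census j062529/30, 5 550 random + 1 480 annealed climbs, `|W| ≤ 4`, `n ≤ 8`; `|W| = 1` is the landed attached
transfer, `|W| = 2` follows from the avoided-vertex union exchange DOM2, now a theorem
(`UnionExchange.pair_avoided_dominance`, 2026-08-20) via UX ⟹ AUT), and a fortiori from its ranking-free form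
(UX) `μ(o↮a, o↔W, light o)·max-odds bound` and from the domination (DOM′) of `law(C_o | o ↔ W, o ↮ a)` by a mixture of the
`law(C_g | g ↮ a)`, `g ∈ W` (loc. cit. §25 (viii)).  Even the weaker transfer with the right-hand side `μ(o ↮ a, light a)`
suffices (it is the cumulative isolation lemma itself, rearranged).

* `lightestRelayTransfer_imp_cumulativeIsolation` — the rearrangement, for one graph;
* `noHeavyLowerTail_of_lightestRelayTransfer` — crux ⟸ (∀ graphs) `μ(o↮a, o↔A∖a, light o) ≤ μ(o↮a, light a)` at the
  lightest relay `a`;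
* `noHeavyLowerTail_of_anchoredUnionTransfer` — crux ⟸ (AUT).
-/

noncomputable section

namespace Summit.CriticalPhenomena.PercolationContinuityZ3.Theorems

open MeasureTheory Set Literature.Probability.LatticeModels Literature.Probability.Percolation
open Summit.CriticalPhenomena.PercolationContinuityZ3.Theses.PercNearOneGluing
open scoped Classical

namespace AnchoredUnionTransfer

/-- **The lightest-relay rearrangement of the cumulative isolation lemma (one graph).**  For `o ∉ A`, `a ∈ A`:
if `μ(o ↮ a, o ↔ (A ∖ a), light o) ≤ μ(o ↮ a, light a)` then `μ{1 ≤ N ∧ 2N ≤ |A|} ≤ μ(light a)` — on `{o ↔ a}` the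
relay counts of `o` and `a` agree. [cite: KozmaNitzan2024, Lemma 2 (p. 6) (the case `|A| ≤ 3`)] -/
theorem lightestRelayTransfer_imp_cumulativeIsolation {n : ℕ} (w : Sym2 (Fin n) → unitInterval)
    (A : Finset (Fin n)) (o a : Fin n)
    (hT : (prodBernoulli w).real ({ω : BondConfig (Fin n) | ¬ (openGraph ω).Reachable o a} ∩
        {ω | ∃ g ∈ A, g ≠ a ∧ (openGraph ω).Reachable o g} ∩
        {ω | 2 * (A.filter fun x => ω ∈ openConn o x).card ≤ A.card}) ≤
      (prodBernoulli w).real ({ω : BondConfig (Fin n) | ¬ (openGraph ω).Reachable o a} ∩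
        {ω | 2 * (A.filter fun x => ω ∈ openConn a x).card ≤ A.card})) :
    (prodBernoulli w).real {ω : BondConfig (Fin n) |
        1 ≤ (A.filter fun x => ω ∈ openConn o x).card ∧
          2 * (A.filter fun x => ω ∈ openConn o x).card ≤ A.card} ≤
      (prodBernoulli w).real {ω : BondConfig (Fin n) |
        2 * (A.filter fun x => ω ∈ openConn a x).card ≤ A.card} := by
  set μ := prodBernoulli w with hμ
  set E : Set (BondConfig (Fin n)) := {ω | 1 ≤ (A.filter fun x => ω ∈ openConn o x).card ∧
      2 * (A.filter fun x => ω ∈ openConn o x).card ≤ A.card} with hE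
  set La : Set (BondConfig (Fin n)) := {ω | 2 * (A.filter fun x => ω ∈ openConn a x).card ≤ A.card} with hLa
  set Oa : Set (BondConfig (Fin n)) := openConn o a with hOa
  have hmeas : ∀ s : Set (BondConfig (Fin n)), MeasurableSet s := fun _ => MeasurableSet.of_discrete
  -- split both sides along `{o ↔ a}`
  have hsplitE : μ.real E = μ.real (E ∩ Oa) + μ.real (E ∩ Oaᶜ) := by
    rw [← measureReal_inter_add_sdiff (s := E) (hmeas Oa), Set.sdiff_eq]
  have hsplitL : μ.real La = μ.real (La ∩ Oa) + μ.real (La ∩ Oaᶜ) := by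
    rw [← measureReal_inter_add_sdiff (s := La) (hmeas Oa), Set.sdiff_eq]
  -- on `{o ↔ a}` the relay counts of `o` and `a` agree
  have h1 : E ∩ Oa ⊆ La ∩ Oa := by
    rintro ω ⟨⟨_, hle⟩, hoa⟩
    refine ⟨?_, hoa⟩
    have heq : (A.filter fun x => ω ∈ openConn a x) = (A.filter fun x => ω ∈ openConn o x) := by
      refine Finset.filter_congr fun x _ => ?_
      exact ⟨fun h => (show (openGraph ω).Reachable o a from hoa).trans h,
        fun h => (show (openGraph ω).Reachable o a from hoa).symm.trans h⟩
    show 2 * (A.filter fun x => ω ∈ openConn a x).card ≤ A.card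
    rw [heq]; exact hle
  -- off `{o ↔ a}`, `1 ≤ N` says that `o` is joined to `A ∖ {a}`
  have h2 : E ∩ Oaᶜ ⊆ {ω : BondConfig (Fin n) | ¬ (openGraph ω).Reachable o a} ∩
      {ω | ∃ g ∈ A, g ≠ a ∧ (openGraph ω).Reachable o g} ∩
      {ω | 2 * (A.filter fun x => ω ∈ openConn o x).card ≤ A.card} := by
    rintro ω ⟨⟨hpos, hle⟩, hoa⟩
    have hoa' : ¬ (openGraph ω).Reachable o a := hoa
    refine ⟨⟨hoa', ?_⟩, hle⟩
    obtain ⟨g, hg⟩ := Finset.card_pos.1 hpos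
    rcases Finset.mem_filter.1 hg with ⟨hgA, hog⟩
    exact ⟨g, hgA, fun h => hoa' (h ▸ hog), hog⟩
  have h3 : {ω : BondConfig (Fin n) | ¬ (openGraph ω).Reachable o a} ∩ La ⊆ La ∩ Oaᶜ := by
    rintro ω ⟨hoa, hl⟩; exact ⟨hl, hoa⟩
  calc μ.real E = μ.real (E ∩ Oa) + μ.real (E ∩ Oaᶜ) := hsplitE
    _ ≤ μ.real (La ∩ Oa) + μ.real (La ∩ Oaᶜ) := by
        refine add_le_add (measureReal_mono h1 (measure_ne_top _ _)) ?_
        exact ((measureReal_mono h2 (measure_ne_top _ _)).trans hT).trans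
          (measureReal_mono h3 (measure_ne_top _ _))
    _ = μ.real La := hsplitL.symm

/-- **The crux from the lightest-relay transfer.**  If for every finite weighted graph, every relay set `A`, every
observer `o ∉ A` and every relay `a ∈ A` maximising `μ(light a)` one has
`μ(o ↮ a, o ↔ (A ∖ a), light o) ≤ μ(o ↮ a, light a)`, then `NoHeavyLowerTail`
(via `noHeavyLowerTail_of_cumulativeIsolation`, constant 2). -/
theorem noHeavyLowerTail_of_lightestRelayTransfer
    (hLRT : ∀ (n : ℕ) (w : Sym2 (Fin n) → unitInterval) (A : Finset (Fin n)) (o a : Fin n),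
      a ∈ A → o ∉ A →
      (∀ g ∈ A, (prodBernoulli w).real {ω : BondConfig (Fin n) |
          2 * (A.filter fun x => ω ∈ openConn g x).card ≤ A.card} ≤
        (prodBernoulli w).real {ω : BondConfig (Fin n) |
          2 * (A.filter fun x => ω ∈ openConn a x).card ≤ A.card}) →
      (prodBernoulli w).real ({ω : BondConfig (Fin n) | ¬ (openGraph ω).Reachable o a} ∩
          {ω | ∃ g ∈ A, g ≠ a ∧ (openGraph ω).Reachable o g} ∩
          {ω | 2 * (A.filter fun x => ω ∈ openConn o x).card ≤ A.card}) ≤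
        (prodBernoulli w).real ({ω : BondConfig (Fin n) | ¬ (openGraph ω).Reachable o a} ∩
          {ω | 2 * (A.filter fun x => ω ∈ openConn a x).card ≤ A.card})) :
    NoHeavyLowerTail := by
  refine noHeavyLowerTail_of_cumulativeIsolation fun n w A o hA ho => ?_
  -- the lightest relay
  obtain ⟨a, ha, hmax⟩ := Finset.exists_max_image A
    (fun g => (prodBernoulli w).real {ω : BondConfig (Fin n) |
      2 * (A.filter fun x => ω ∈ openConn g x).card ≤ A.card}) hA
  exact ⟨a, ha, lightestRelayTransfer_imp_cumulativeIsolation w A o a (hLRT n w A o a ha ho hmax)⟩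

/-- **The crux from the ANCHORED UNION TRANSFER (AUT).**  If for every finite weighted graph, relay set `A`, observer
`o ∉ A` and relay `a ∈ A` with `μ(light g) ≤ μ(light a)` for all `g ∈ A`:
`μ(o ↮ a, o ↔ (A ∖ a), light o) ≤ μ(o ↮ a, o ↔ (A ∖ a), light a)`
("on the event that `o` avoids the lightest relay but grabs another one, the cluster of `o` is less likely to be
light than the cluster of the lightest relay"), then `NoHeavyLowerTail`.  (BLOBQUOTIENT §25 (vii): AUT, 0 violations;
`|W| = 1` attached transfer, `|W| = 2` from DOM2.) -/
theorem noHeavyLowerTail_of_anchoredUnionTransfer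
    (hAUT : ∀ (n : ℕ) (w : Sym2 (Fin n) → unitInterval) (A : Finset (Fin n)) (o a : Fin n),
      a ∈ A → o ∉ A →
      (∀ g ∈ A, (prodBernoulli w).real {ω : BondConfig (Fin n) |
          2 * (A.filter fun x => ω ∈ openConn g x).card ≤ A.card} ≤
        (prodBernoulli w).real {ω : BondConfig (Fin n) |
          2 * (A.filter fun x => ω ∈ openConn a x).card ≤ A.card}) →
      (prodBernoulli w).real ({ω : BondConfig (Fin n) | ¬ (openGraph ω).Reachable o a} ∩
          {ω | ∃ g ∈ A, g ≠ a ∧ (openGraph ω).Reachable o g} ∩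
          {ω | 2 * (A.filter fun x => ω ∈ openConn o x).card ≤ A.card}) ≤
        (prodBernoulli w).real ({ω : BondConfig (Fin n) | ¬ (openGraph ω).Reachable o a} ∩
          {ω | ∃ g ∈ A, g ≠ a ∧ (openGraph ω).Reachable o g} ∩
          {ω | 2 * (A.filter fun x => ω ∈ openConn a x).card ≤ A.card})) :
    NoHeavyLowerTail := by
  refine noHeavyLowerTail_of_lightestRelayTransfer fun n w A o a ha ho hmax => ?_
  refine (hAUT n w A o a ha ho hmax).trans (measureReal_mono ?_ (measure_ne_top _ _))
  rintro ω ⟨⟨hoa, _⟩, hl⟩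
  exact ⟨hoa, hl⟩

end AnchoredUnionTransfer

end Summit.CriticalPhenomena.PercolationContinuityZ3.Theorems

end
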